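import Summits.QuantumFields.YangMills.Theorems.VirialFluxGapRegularityCutoff
import HarnessLib

/-!
# Route `VirialFluxGap` (YangMills): the POINTWISE PATCHING CALCULUS of the Euler field — deficit cut-off `ψ(F₀/t₀)` times a partition
# `χ·c¹ + (1 − χ)·c²` of two coefficient families: positivity, drive and divergence of the patched field from those of the pieces

Feeds ✓`FixField.periodicSoftness_of_smoothFrameField_cutoff` (w2 g52): that reduction asks, for SMOOTH coefficients `c_va` of the matrix
coordinates, (pos) `0 ≤ Σ c·g` everywhere, (drive) `2(1−ε)F ≤ Σ c·g` on the small-deficit window, (div) `Σ_va ∂_va c_va ≤ 18L⁴ − 2c₁` everywhere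
(`g = frameGrad τ`, `∂_va = frameD (τ va)`).  The field of the team is PATCHED: `c_j := ψ(F₀/t₀)·(χ·c¹_j + (1 − χ)·c²_j)` with fcl-p3's smooth step
`ψ = deficitStep` (✓`VirialFluxGapResolventFieldStep`), a smooth partition function `χ ∈ [0,1]` (e.g. w2's ✓`RegCutoff.regCutoff ρ`), the generic
resolvent coefficients `c¹ = 2·resolventCoeff` (fcl-p3, valid where `χ ≠ 0`) and the central-chart coefficients `c²` (w3 lineage, valid where `χ ≠ 1`).
This file does the pointwise bookkeeping ONCE, for an arbitrary finite frame family `τ`: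

* `contDiff_patchCoeff` — the patched coefficients are smooth (hypothesis `hc` of the last-mile reduction);
* ★ `patch_drive_nonneg` — (pos): if each piece has `0 ≤ Σ_j cⁱ_j g_j` where it is weighted, then `0 ≤ Σ_j c_j g_j`;
* ★ `patch_drive` — (drive): on `{F₀ ≤ t₀/2}` (`ψ = 1`), if each piece has `a ≤ Σ_j cⁱ_j g_j` where it is weighted, then `a ≤ Σ_j c_j g_j`;
* ★★ `sum_frameD_patch` — the DIVERGENCE IDENTITY
  `Σ_j ∂_j c_j = ψ′(F₀/t₀)/t₀ · Σ_j g_j·(χc¹ + (1−χ)c²)_j + ψ(F₀/t₀)·(χ·Σ_j∂_jc¹_j + (1−χ)·Σ_j∂_jc²_j + Σ_j ∂_jχ·(c¹_j − c²_j))`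
  (✓`frameD_deficitCutoff`, ✓`RegCutoff.frameD_mul ∕ frameD_patch`);
* ★★★ `patch_div_le` — (div): the first term is `≤ 0` (`ψ′ ≤ 0`, (pos) of the pieces — the general form of fcl-p3's ✓`deficitCutoff_term_nonpos`),
  so if each piece has divergence `≤ D` where it is weighted and the CROSS TERM satisfies `|Σ_j ∂_jχ·(c¹_j − c²_j)| ≤ X` with `0 ≤ D + X`, then
  `Σ_j ∂_j c_j ≤ D + X`; `patch_div_le_target` — hence `≤ T` for any target `T ≥ D + X` (take `T = 18L⁴ − 2c₁`).
* §4 (referee ruling LEAD g92 02:02Z) ★★★ `patch_div_le_signed` ∕ `patch_div_le_target_signed` — the same with the cross term bounded ONE-SIDEDLY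
  (`Σ_j ∂_jχ·(c¹_j − c²_j) ≤ X`: its main part is `≤ 0`, only the remainder is small); `cross_term_eq_zero_of_frameD_eq_zero`.
* §5 ★★ WINDOW forms: `deriv_deficitStep_eq_zero` (`r ≥ 1` or `r ≤ ½`), `patch_div_eq_zero_of_ge` ∕ `patch_drive_eq_zero_of_ge` (off `{F₀ < t₀}` the patched
  field is inert), `patch_drive_nonneg_window`, ★★★ `patch_div_le_signed_window`, `patch_drive_window` — every hypothesis on the pieces is needed ONLY on
  the deficit window `{F₀ < t₀}` (the central and generic packages are window statements).
So the assembly of «EulerFieldFix» is reduced to THREE pointwise inputs on `X_fix`: the generic package where `χ_reg ≠ 0` (✓`fix_generic_*_eps`), the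
central package where `χ_reg ≠ 1` (w3 lineage), and the cross-term bound (✓`exists_bound_frameD_regCutoff`-type `C/ρ²` × `12` directions × `|c¹|+|c²|`).

HONEST FRAMING: pointwise algebra (theorems only, 0 `def`, 0 `sorry`, standard axioms); no coefficient field is constructed, neither chart's inequalities
are proved here; ⟨stmt-QuantumFields-24141⟩ and ⟨22884⟩ stay OPEN; no stub ∕ crux ∕ rung ∕ summit is closed; the Yang–Mills mass gap is NOT proved;
no summit is proved by a line.  Width seat `ym-line-sfw-p2-w2` g52 (cell ym-idea-1, free hands), `--supports stmt-QuantumFields-24141`.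
References: [cite: Griffiths1964] (virial ∕ equipartition); [folklore] (partitions of unity).
-/

set_option autoImplicit false

noncomputable section

open scoped Matrix BigOperators ContDiff Topology
open MeasureTheory
open Literature.MathematicalPhysics.QuantumFieldTheory hiding SU2
open Literature.MathematicalPhysics.QuantumLattice
open Literature.MathematicalPhysics.QuantumFieldTheory.SUNBakryEmery (expSU coe_expSU matTop)

namespace Summit.QuantumFields.YangMills.Theorems.VirialFluxGap.FieldPatching

open Summit.QuantumFields.YangMills.Theorems.FemtoTransferGap
open Summit.QuantumFields.YangMills.Theorems.FemtoTransferGap.TT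
open Summit.QuantumFields.YangMills.Theorems.VirialFluxGap.RingDeficit
open Summit.QuantumFields.YangMills.Theorems.VirialFluxGap.FrameDerivative
open Summit.QuantumFields.YangMills.Theorems.VirialFluxGap.FrameHessian
open Summit.QuantumFields.YangMills.Theorems.VirialFluxGap.RegCutoff

variable {L : ℕ} [NeZero L]
variable {ι : Type*} [Fintype ι]

open scoped Matrix.Norms.Frobenius

attribute [local instance 2000] Literature.MathematicalPhysics.QuantumFieldTheory.SUNBakryEmery.matTop

/-! ## §1 Smoothness of the patched coefficients -/

omit [Fintype ι] in
/-- ★ The patched coefficients `ψ(F₀/t₀)·(χ·c¹_j + (1−χ)·c²_j)` are smooth functions of the coordinates. [folklore] -/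
theorem contDiff_patchCoeff
    {χ : ((Fin (2 * L - 1 + 1) → Edge 3 L → Matrix (Fin 2) (Fin 2) ℂ) × (Site 3 L → Matrix (Fin 2) (Fin 2) ℂ)) → ℝ} (hχ : ContDiff ℝ ∞ χ)
    {c₁ c₂ : ι → ((Fin (2 * L - 1 + 1) → Edge 3 L → Matrix (Fin 2) (Fin 2) ℂ) × (Site 3 L → Matrix (Fin 2) (Fin 2) ℂ)) → ℝ}
    (h₁ : ∀ j, ContDiff ℝ ∞ (c₁ j)) (h₂ : ∀ j, ContDiff ℝ ∞ (c₂ j)) (t₀ : ℝ) (j : ι) :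
    ContDiff ℝ ∞ fun M => deficitStep (ringPoly L M / t₀) * (χ M * c₁ j M + (1 - χ M) * c₂ j M) :=
  (contDiff_deficitStep.comp ((contDiff_ringPoly (L := L)).div_const t₀)).mul (contDiff_patch hχ (h₁ j) (h₂ j))

/-! ## §2 Positivity and drive of the patched field -/

/-- A convex combination of two quantities each `≥ a` where it is weighted is `≥ a`. [folklore] -/
theorem convex_comb_ge {χ a u v : ℝ} (h0 : 0 ≤ χ) (h1 : χ ≤ 1) (hu : χ ≠ 0 → a ≤ u) (hv : χ ≠ 1 → a ≤ v) :
    a ≤ χ * u + (1 - χ) * v := by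
  by_cases hχ0 : χ = 0
  · rw [hχ0, zero_mul, zero_add, sub_zero, one_mul]
    exact hv (by rw [hχ0]; norm_num)
  · by_cases hχ1 : χ = 1
    · rw [hχ1, one_mul, sub_self, zero_mul, add_zero]
      exact hu hχ0
    · have hu' := hu hχ0
      have hv' := hv hχ1
      nlinarith

/-- The drive of the patched field factors: `Σ_j c_j g_j = ψ(F₀/t₀)·(χ·Σ_j c¹_j g_j + (1−χ)·Σ_j c²_j g_j)`. [folklore] -/
theorem sum_patch_mul (ψv χv : ℝ) (c₁ c₂ g : ι → ℝ) :
    ∑ j, ψv * (χv * c₁ j + (1 - χv) * c₂ j) * g j = ψv * (χv * ∑ j, c₁ j * g j + (1 - χv) * ∑ j, c₂ j * g j) := by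
  simp only [Finset.mul_sum, ← Finset.sum_add_distrib]
  refine Finset.sum_congr rfl fun j _ => ?_
  ring

/-- ★ **(pos) of the patched field**: if the generic piece has `0 ≤ Σ c¹·g` wherever `χ ≠ 0` and the central piece `0 ≤ Σ c²·g` wherever `χ ≠ 1`
(`0 ≤ χ ≤ 1`), then `0 ≤ Σ_j ψ(F₀/t₀)(χc¹_j + (1−χ)c²_j)·g_j`. [folklore] -/
theorem patch_drive_nonneg (τ : ι → ((Fin (2 * L - 1 + 1) × Edge 3 L) ⊕ Site 3 L) → Matrix (Fin 2) (Fin 2) ℂ)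
    (χ : ((Fin (2 * L - 1 + 1) → Edge 3 L → Matrix (Fin 2) (Fin 2) ℂ) × (Site 3 L → Matrix (Fin 2) (Fin 2) ℂ)) → ℝ)
    (c₁ c₂ : ι → ((Fin (2 * L - 1 + 1) → Edge 3 L → Matrix (Fin 2) (Fin 2) ℂ) × (Site 3 L → Matrix (Fin 2) (Fin 2) ℂ)) → ℝ) (t₀ : ℝ)
    (M : (Fin (2 * L - 1 + 1) → Edge 3 L → Matrix (Fin 2) (Fin 2) ℂ) × (Site 3 L → Matrix (Fin 2) (Fin 2) ℂ))
    (h0 : 0 ≤ χ M) (h1 : χ M ≤ 1) (hg : χ M ≠ 0 → 0 ≤ ∑ j, c₁ j M * frameGrad (L := L) τ M j)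
    (hc : χ M ≠ 1 → 0 ≤ ∑ j, c₂ j M * frameGrad (L := L) τ M j) :
    0 ≤ ∑ j, deficitStep (ringPoly L M / t₀) * (χ M * c₁ j M + (1 - χ M) * c₂ j M) * frameGrad (L := L) τ M j := by
  rw [sum_patch_mul]
  exact mul_nonneg (deficitStep_nonneg _) (by nlinarith [convex_comb_ge h0 h1 hg hc])

/-- ★ **(drive) of the patched field on the window `{F₀ ≤ t₀/2}`** (`ψ = 1` there): if the generic piece has `a ≤ Σ c¹·g` wherever `χ ≠ 0` and the
central piece `a ≤ Σ c²·g` wherever `χ ≠ 1`, then `a ≤ Σ_j c_j g_j` (take `a = 2(1−ε)F₀`). [cite: Griffiths1964] -/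
theorem patch_drive (τ : ι → ((Fin (2 * L - 1 + 1) × Edge 3 L) ⊕ Site 3 L) → Matrix (Fin 2) (Fin 2) ℂ)
    (χ : ((Fin (2 * L - 1 + 1) → Edge 3 L → Matrix (Fin 2) (Fin 2) ℂ) × (Site 3 L → Matrix (Fin 2) (Fin 2) ℂ)) → ℝ)
    (c₁ c₂ : ι → ((Fin (2 * L - 1 + 1) → Edge 3 L → Matrix (Fin 2) (Fin 2) ℂ) × (Site 3 L → Matrix (Fin 2) (Fin 2) ℂ)) → ℝ) {t₀ a : ℝ}
    (M : (Fin (2 * L - 1 + 1) → Edge 3 L → Matrix (Fin 2) (Fin 2) ℂ) × (Site 3 L → Matrix (Fin 2) (Fin 2) ℂ))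
    (ht₀ : 0 < t₀) (hF : ringPoly L M ≤ t₀ / 2) (h0 : 0 ≤ χ M) (h1 : χ M ≤ 1)
    (hg : χ M ≠ 0 → a ≤ ∑ j, c₁ j M * frameGrad (L := L) τ M j) (hc : χ M ≠ 1 → a ≤ ∑ j, c₂ j M * frameGrad (L := L) τ M j) :
    a ≤ ∑ j, deficitStep (ringPoly L M / t₀) * (χ M * c₁ j M + (1 - χ M) * c₂ j M) * frameGrad (L := L) τ M j := by
  rw [sum_patch_mul, deficitStep_eq_one (by rw [div_le_iff₀ ht₀]; linarith), one_mul]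
  exact convex_comb_ge h0 h1 hg hc

/-! ## §3 The divergence of the patched field -/

/-- ★★ **The divergence identity of the patched field.** [folklore] -/
theorem sum_frameD_patch (τ : ι → ((Fin (2 * L - 1 + 1) × Edge 3 L) ⊕ Site 3 L) → Matrix (Fin 2) (Fin 2) ℂ)
    {χ : ((Fin (2 * L - 1 + 1) → Edge 3 L → Matrix (Fin 2) (Fin 2) ℂ) × (Site 3 L → Matrix (Fin 2) (Fin 2) ℂ)) → ℝ} (hχ : ContDiff ℝ ∞ χ)
    {c₁ c₂ : ι → ((Fin (2 * L - 1 + 1) → Edge 3 L → Matrix (Fin 2) (Fin 2) ℂ) × (Site 3 L → Matrix (Fin 2) (Fin 2) ℂ)) → ℝ}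
    (h₁ : ∀ j, ContDiff ℝ ∞ (c₁ j)) (h₂ : ∀ j, ContDiff ℝ ∞ (c₂ j)) (t₀ : ℝ)
    (M : (Fin (2 * L - 1 + 1) → Edge 3 L → Matrix (Fin 2) (Fin 2) ℂ) × (Site 3 L → Matrix (Fin 2) (Fin 2) ℂ)) :
    ∑ j, frameD (τ j) (fun M' => deficitStep (ringPoly L M' / t₀) * (χ M' * c₁ j M' + (1 - χ M') * c₂ j M')) M =
      deriv deficitStep (ringPoly L M / t₀) / t₀ * ∑ j, frameGrad (L := L) τ M j * (χ M * c₁ j M + (1 - χ M) * c₂ j M) +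
        deficitStep (ringPoly L M / t₀) *
          (χ M * ∑ j, frameD (τ j) (c₁ j) M + (1 - χ M) * ∑ j, frameD (τ j) (c₂ j) M + ∑ j, frameD (τ j) χ M * (c₁ j M - c₂ j M)) := by
  have hψ : ContDiff ℝ ∞ fun M' : ((Fin (2 * L - 1 + 1) → Edge 3 L → Matrix (Fin 2) (Fin 2) ℂ) × (Site 3 L → Matrix (Fin 2) (Fin 2) ℂ)) =>
      deficitStep (ringPoly L M' / t₀) := contDiff_deficitStep.comp ((contDiff_ringPoly (L := L)).div_const t₀)
  have hterm : ∀ j, frameD (τ j) (fun M' => deficitStep (ringPoly L M' / t₀) * (χ M' * c₁ j M' + (1 - χ M') * c₂ j M')) M =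
      deficitStep (ringPoly L M / t₀) * (χ M * frameD (τ j) (c₁ j) M + (1 - χ M) * frameD (τ j) (c₂ j) M + frameD (τ j) χ M * (c₁ j M - c₂ j M)) +
        (χ M * c₁ j M + (1 - χ M) * c₂ j M) * (deriv deficitStep (ringPoly L M / t₀) / t₀ * frameGrad (L := L) τ M j) := fun j => by
    rw [frameD_mul hψ (contDiff_patch hχ (h₁ j) (h₂ j)), frameD_patch hχ (h₁ j) (h₂ j), frameD_deficitCutoff contDiff_deficitStep τ j M]
  rw [Finset.sum_congr rfl fun j _ => hterm j]
  simp only [Finset.mul_sum, ← Finset.sum_add_distrib]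
  exact Finset.sum_congr rfl fun j _ => by ring

/-- The signed deficit cut-off term for ANY coefficients with non-negative drive: `ψ′(F₀/t₀)/t₀ · Σ_j g_j c̃_j ≤ 0` (`ψ′ ≤ 0`, `t₀ > 0`,
`Σ g c̃ ≥ 0`) — the general form of fcl-p3's ✓`deficitCutoff_term_nonpos`. [folklore] -/
theorem cutoff_term_nonpos {t₀ r S : ℝ} (ht₀ : 0 < t₀) (hS : 0 ≤ S) : deriv deficitStep r / t₀ * S ≤ 0 :=
  mul_nonpos_of_nonpos_of_nonneg (div_nonpos_of_nonpos_of_nonneg (deriv_deficitStep_nonpos r) ht₀.le) hS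

/-- ★★★ **(div) of the patched field.**  At a point `M` with `0 ≤ χ ≤ 1`: if the generic piece has `Σ_j∂_jc¹_j ≤ D` and `0 ≤ Σ c¹·g` wherever `χ ≠ 0`,
the central piece `Σ_j∂_jc²_j ≤ D` and `0 ≤ Σ c²·g` wherever `χ ≠ 1`, and the cross term obeys `|Σ_j ∂_jχ·(c¹_j − c²_j)| ≤ X` with `0 ≤ D + X`,
then `Σ_j ∂_j[ψ(F₀/t₀)(χc¹_j + (1−χ)c²_j)] ≤ D + X` (`t₀ > 0`). [cite: Griffiths1964] -/
theorem patch_div_le (τ : ι → ((Fin (2 * L - 1 + 1) × Edge 3 L) ⊕ Site 3 L) → Matrix (Fin 2) (Fin 2) ℂ)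
    {χ : ((Fin (2 * L - 1 + 1) → Edge 3 L → Matrix (Fin 2) (Fin 2) ℂ) × (Site 3 L → Matrix (Fin 2) (Fin 2) ℂ)) → ℝ} (hχ : ContDiff ℝ ∞ χ)
    {c₁ c₂ : ι → ((Fin (2 * L - 1 + 1) → Edge 3 L → Matrix (Fin 2) (Fin 2) ℂ) × (Site 3 L → Matrix (Fin 2) (Fin 2) ℂ)) → ℝ}
    (h₁ : ∀ j, ContDiff ℝ ∞ (c₁ j)) (h₂ : ∀ j, ContDiff ℝ ∞ (c₂ j)) {t₀ D X : ℝ} (ht₀ : 0 < t₀)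
    (M : (Fin (2 * L - 1 + 1) → Edge 3 L → Matrix (Fin 2) (Fin 2) ℂ) × (Site 3 L → Matrix (Fin 2) (Fin 2) ℂ))
    (h0 : 0 ≤ χ M) (h1 : χ M ≤ 1)
    (hg : χ M ≠ 0 → 0 ≤ ∑ j, c₁ j M * frameGrad (L := L) τ M j) (hc : χ M ≠ 1 → 0 ≤ ∑ j, c₂ j M * frameGrad (L := L) τ M j)
    (hdiv₁ : χ M ≠ 0 → ∑ j, frameD (τ j) (c₁ j) M ≤ D) (hdiv₂ : χ M ≠ 1 → ∑ j, frameD (τ j) (c₂ j) M ≤ D)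
    (hX : |∑ j, frameD (τ j) χ M * (c₁ j M - c₂ j M)| ≤ X) (hDX : 0 ≤ D + X) :
    ∑ j, frameD (τ j) (fun M' => deficitStep (ringPoly L M' / t₀) * (χ M' * c₁ j M' + (1 - χ M') * c₂ j M')) M ≤ D + X := by
  rw [sum_frameD_patch τ hχ h₁ h₂ t₀ M]
  -- the signed cut-off term
  have hS : 0 ≤ ∑ j, frameGrad (L := L) τ M j * (χ M * c₁ j M + (1 - χ M) * c₂ j M) := by
    have e : ∑ j, frameGrad (L := L) τ M j * (χ M * c₁ j M + (1 - χ M) * c₂ j M) =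
        χ M * ∑ j, c₁ j M * frameGrad (L := L) τ M j + (1 - χ M) * ∑ j, c₂ j M * frameGrad (L := L) τ M j := by
      simp only [Finset.mul_sum, ← Finset.sum_add_distrib]
      exact Finset.sum_congr rfl fun j _ => by ring
    rw [e]
    nlinarith [convex_comb_ge h0 h1 hg hc]
  have hcut := cutoff_term_nonpos (r := ringPoly L M / t₀) ht₀ hS
  -- the weighted divergences and the cross term
  have hmain : χ M * ∑ j, frameD (τ j) (c₁ j) M + (1 - χ M) * ∑ j, frameD (τ j) (c₂ j) M +
      ∑ j, frameD (τ j) χ M * (c₁ j M - c₂ j M) ≤ D + X := by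
    have hcross : ∑ j, frameD (τ j) χ M * (c₁ j M - c₂ j M) ≤ X := (le_abs_self _).trans hX
    have hneg₁ : χ M ≠ 0 → -∑ j, frameD (τ j) (c₁ j) M ≥ -D := fun h => by linarith [hdiv₁ h]
    have hneg₂ : χ M ≠ 1 → -∑ j, frameD (τ j) (c₂ j) M ≥ -D := fun h => by linarith [hdiv₂ h]
    have hconv := convex_comb_ge (a := -D) h0 h1 hneg₁ hneg₂
    linarith
  have hψ0 := deficitStep_nonneg (ringPoly L M / t₀)
  have hψ1 := deficitStep_le_one (ringPoly L M / t₀)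
  nlinarith [mul_le_mul_of_nonneg_left hmain hψ0, mul_le_mul_of_nonneg_right hψ1 hDX]

/-- ★ (div) against a target: under the hypotheses of `patch_div_le` and `D + X ≤ T`, the patched divergence is `≤ T` (take `T = 18L⁴ − 2c₁`). [folklore] -/
theorem patch_div_le_target (τ : ι → ((Fin (2 * L - 1 + 1) × Edge 3 L) ⊕ Site 3 L) → Matrix (Fin 2) (Fin 2) ℂ)
    {χ : ((Fin (2 * L - 1 + 1) → Edge 3 L → Matrix (Fin 2) (Fin 2) ℂ) × (Site 3 L → Matrix (Fin 2) (Fin 2) ℂ)) → ℝ} (hχ : ContDiff ℝ ∞ χ)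
    {c₁ c₂ : ι → ((Fin (2 * L - 1 + 1) → Edge 3 L → Matrix (Fin 2) (Fin 2) ℂ) × (Site 3 L → Matrix (Fin 2) (Fin 2) ℂ)) → ℝ}
    (h₁ : ∀ j, ContDiff ℝ ∞ (c₁ j)) (h₂ : ∀ j, ContDiff ℝ ∞ (c₂ j)) {t₀ D X T : ℝ} (ht₀ : 0 < t₀)
    (M : (Fin (2 * L - 1 + 1) → Edge 3 L → Matrix (Fin 2) (Fin 2) ℂ) × (Site 3 L → Matrix (Fin 2) (Fin 2) ℂ))
    (h0 : 0 ≤ χ M) (h1 : χ M ≤ 1)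
    (hg : χ M ≠ 0 → 0 ≤ ∑ j, c₁ j M * frameGrad (L := L) τ M j) (hc : χ M ≠ 1 → 0 ≤ ∑ j, c₂ j M * frameGrad (L := L) τ M j)
    (hdiv₁ : χ M ≠ 0 → ∑ j, frameD (τ j) (c₁ j) M ≤ D) (hdiv₂ : χ M ≠ 1 → ∑ j, frameD (τ j) (c₂ j) M ≤ D)
    (hX : |∑ j, frameD (τ j) χ M * (c₁ j M - c₂ j M)| ≤ X) (hDX : 0 ≤ D + X) (hT : D + X ≤ T) :
    ∑ j, frameD (τ j) (fun M' => deficitStep (ringPoly L M' / t₀) * (χ M' * c₁ j M' + (1 - χ M') * c₂ j M')) M ≤ T :=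
  (patch_div_le τ hχ h₁ h₂ ht₀ M h0 h1 hg hc hdiv₁ hdiv₂ hX hDX).trans hT

/-- ★ **Cross-term bookkeeping**: if `∂_jχ = 0` off a finite set `S` of directions, `|∂_jχ| ≤ B` on `S`, and `|c¹_j − c²_j| ≤ δ` on `S`, then
`|Σ_j ∂_jχ·(c¹_j − c²_j)| ≤ #S·B·δ` (for `χ_reg`: `#S = 12`, `B = C/ρ²`, `δ = O(√t₀)`). [folklore] -/
theorem cross_term_le [DecidableEq ι] (S : Finset ι) {d e : ι → ℝ} {B δ : ℝ} (hB : 0 ≤ B)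
    (hoff : ∀ j, j ∉ S → d j = 0) (hd : ∀ j ∈ S, |d j| ≤ B) (he : ∀ j ∈ S, |e j| ≤ δ) :
    |∑ j, d j * e j| ≤ S.card * B * δ := by
  classical
  have hsplit : ∑ j, d j * e j = ∑ j ∈ S, d j * e j := by
    rw [← Finset.sum_subset (Finset.subset_univ S)]
    intro j _ hj
    rw [hoff j hj, zero_mul]
  rw [hsplit]
  calc |∑ j ∈ S, d j * e j| ≤ ∑ j ∈ S, |d j * e j| := Finset.abs_sum_le_sum_abs _ _
    _ ≤ ∑ _j ∈ S, B * δ := Finset.sum_le_sum fun j hj => by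
        rw [abs_mul]; exact mul_le_mul (hd j hj) (he j hj) (abs_nonneg _) hB
    _ = S.card * B * δ := by rw [Finset.sum_const, nsmul_eq_mul]; ring

/-! ## §4 The SIGNED form of the divergence budget (referee ruling LEAD g92, 2026-08-31T02:02Z) -/

/-- ★★★ **(div) of the patched field, SIGNED cross term.**  Same as `patch_div_le` but the cross term is bounded ONE-SIDEDLY:
`Σ_j ∂_jχ·(c¹_j − c²_j) ≤ X` (its main part is non-positive by the radial monotonicity of the masses and the sign input of the central field, only the
remainder is small — an absolute bound would eat the margin).  Conclusion: `Σ_j ∂_j[ψ(F₀/t₀)(χc¹_j + (1−χ)c²_j)] ≤ D + X` whenever `0 ≤ D + X`.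
[cite: Griffiths1964] -/
theorem patch_div_le_signed (τ : ι → ((Fin (2 * L - 1 + 1) × Edge 3 L) ⊕ Site 3 L) → Matrix (Fin 2) (Fin 2) ℂ)
    {χ : ((Fin (2 * L - 1 + 1) → Edge 3 L → Matrix (Fin 2) (Fin 2) ℂ) × (Site 3 L → Matrix (Fin 2) (Fin 2) ℂ)) → ℝ} (hχ : ContDiff ℝ ∞ χ)
    {c₁ c₂ : ι → ((Fin (2 * L - 1 + 1) → Edge 3 L → Matrix (Fin 2) (Fin 2) ℂ) × (Site 3 L → Matrix (Fin 2) (Fin 2) ℂ)) → ℝ}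
    (h₁ : ∀ j, ContDiff ℝ ∞ (c₁ j)) (h₂ : ∀ j, ContDiff ℝ ∞ (c₂ j)) {t₀ D X : ℝ} (ht₀ : 0 < t₀)
    (M : (Fin (2 * L - 1 + 1) → Edge 3 L → Matrix (Fin 2) (Fin 2) ℂ) × (Site 3 L → Matrix (Fin 2) (Fin 2) ℂ))
    (h0 : 0 ≤ χ M) (h1 : χ M ≤ 1)
    (hg : χ M ≠ 0 → 0 ≤ ∑ j, c₁ j M * frameGrad (L := L) τ M j) (hc : χ M ≠ 1 → 0 ≤ ∑ j, c₂ j M * frameGrad (L := L) τ M j)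
    (hdiv₁ : χ M ≠ 0 → ∑ j, frameD (τ j) (c₁ j) M ≤ D) (hdiv₂ : χ M ≠ 1 → ∑ j, frameD (τ j) (c₂ j) M ≤ D)
    (hX : ∑ j, frameD (τ j) χ M * (c₁ j M - c₂ j M) ≤ X) (hDX : 0 ≤ D + X) :
    ∑ j, frameD (τ j) (fun M' => deficitStep (ringPoly L M' / t₀) * (χ M' * c₁ j M' + (1 - χ M') * c₂ j M')) M ≤ D + X := by
  rw [sum_frameD_patch τ hχ h₁ h₂ t₀ M]
  -- the signed cut-off term
  have hS : 0 ≤ ∑ j, frameGrad (L := L) τ M j * (χ M * c₁ j M + (1 - χ M) * c₂ j M) := by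
    have e : ∑ j, frameGrad (L := L) τ M j * (χ M * c₁ j M + (1 - χ M) * c₂ j M) =
        χ M * ∑ j, c₁ j M * frameGrad (L := L) τ M j + (1 - χ M) * ∑ j, c₂ j M * frameGrad (L := L) τ M j := by
      simp only [Finset.mul_sum, ← Finset.sum_add_distrib]
      exact Finset.sum_congr rfl fun j _ => by ring
    rw [e]
    nlinarith [convex_comb_ge h0 h1 hg hc]
  have hcut := cutoff_term_nonpos (r := ringPoly L M / t₀) ht₀ hS
  -- the weighted divergences and the (signed) cross term
  have hmain : χ M * ∑ j, frameD (τ j) (c₁ j) M + (1 - χ M) * ∑ j, frameD (τ j) (c₂ j) M +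
      ∑ j, frameD (τ j) χ M * (c₁ j M - c₂ j M) ≤ D + X := by
    have hneg₁ : χ M ≠ 0 → -∑ j, frameD (τ j) (c₁ j) M ≥ -D := fun h => by linarith [hdiv₁ h]
    have hneg₂ : χ M ≠ 1 → -∑ j, frameD (τ j) (c₂ j) M ≥ -D := fun h => by linarith [hdiv₂ h]
    have hconv := convex_comb_ge (a := -D) h0 h1 hneg₁ hneg₂
    linarith
  have hψ0 := deficitStep_nonneg (ringPoly L M / t₀)
  have hψ1 := deficitStep_le_one (ringPoly L M / t₀)
  nlinarith [mul_le_mul_of_nonneg_left hmain hψ0, mul_le_mul_of_nonneg_right hψ1 hDX]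

/-- ★ (div) against a target, SIGNED cross term: under the hypotheses of `patch_div_le_signed` and `D + X ≤ T`, the patched divergence is `≤ T`
(referee's budget: `D = 18L⁴ − ¾`, `X = ¼`, `T = 18L⁴ − ½ = 18L⁴ − 2c₁` with `c₁ = ¼`). [folklore] -/
theorem patch_div_le_target_signed (τ : ι → ((Fin (2 * L - 1 + 1) × Edge 3 L) ⊕ Site 3 L) → Matrix (Fin 2) (Fin 2) ℂ)
    {χ : ((Fin (2 * L - 1 + 1) → Edge 3 L → Matrix (Fin 2) (Fin 2) ℂ) × (Site 3 L → Matrix (Fin 2) (Fin 2) ℂ)) → ℝ} (hχ : ContDiff ℝ ∞ χ)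
    {c₁ c₂ : ι → ((Fin (2 * L - 1 + 1) → Edge 3 L → Matrix (Fin 2) (Fin 2) ℂ) × (Site 3 L → Matrix (Fin 2) (Fin 2) ℂ)) → ℝ}
    (h₁ : ∀ j, ContDiff ℝ ∞ (c₁ j)) (h₂ : ∀ j, ContDiff ℝ ∞ (c₂ j)) {t₀ D X T : ℝ} (ht₀ : 0 < t₀)
    (M : (Fin (2 * L - 1 + 1) → Edge 3 L → Matrix (Fin 2) (Fin 2) ℂ) × (Site 3 L → Matrix (Fin 2) (Fin 2) ℂ))
    (h0 : 0 ≤ χ M) (h1 : χ M ≤ 1)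
    (hg : χ M ≠ 0 → 0 ≤ ∑ j, c₁ j M * frameGrad (L := L) τ M j) (hc : χ M ≠ 1 → 0 ≤ ∑ j, c₂ j M * frameGrad (L := L) τ M j)
    (hdiv₁ : χ M ≠ 0 → ∑ j, frameD (τ j) (c₁ j) M ≤ D) (hdiv₂ : χ M ≠ 1 → ∑ j, frameD (τ j) (c₂ j) M ≤ D)
    (hX : ∑ j, frameD (τ j) χ M * (c₁ j M - c₂ j M) ≤ X) (hDX : 0 ≤ D + X) (hT : D + X ≤ T) :
    ∑ j, frameD (τ j) (fun M' => deficitStep (ringPoly L M' / t₀) * (χ M' * c₁ j M' + (1 - χ M') * c₂ j M')) M ≤ T :=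
  (patch_div_le_signed τ hχ h₁ h₂ ht₀ M h0 h1 hg hc hdiv₁ hdiv₂ hX hDX).trans hT

omit [NeZero L] in
/-- The cross term VANISHES where `χ` is locally constant (off the transition region): there `∂_jχ = 0` for every `j`. [folklore] -/
theorem cross_term_eq_zero_of_frameD_eq_zero (τ : ι → ((Fin (2 * L - 1 + 1) × Edge 3 L) ⊕ Site 3 L) → Matrix (Fin 2) (Fin 2) ℂ)
    {χ : ((Fin (2 * L - 1 + 1) → Edge 3 L → Matrix (Fin 2) (Fin 2) ℂ) × (Site 3 L → Matrix (Fin 2) (Fin 2) ℂ)) → ℝ}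
    (c₁ c₂ : ι → ((Fin (2 * L - 1 + 1) → Edge 3 L → Matrix (Fin 2) (Fin 2) ℂ) × (Site 3 L → Matrix (Fin 2) (Fin 2) ℂ)) → ℝ)
    {M : (Fin (2 * L - 1 + 1) → Edge 3 L → Matrix (Fin 2) (Fin 2) ℂ) × (Site 3 L → Matrix (Fin 2) (Fin 2) ℂ)}
    (hχ0 : ∀ j, frameD (τ j) χ M = 0) : ∑ j, frameD (τ j) χ M * (c₁ j M - c₂ j M) = 0 :=
  Finset.sum_eq_zero fun j _ => by rw [hχ0 j, zero_mul]

/-! ## §5 Off the deficit window the patched field is inert; WINDOW forms of the budgets (the pieces are only needed on `{F₀ < t₀}`) -/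

omit [Fintype ι] in
/-- `ψ′(r) = 0` for `r ≥ 1` (global minimum of `ψ ≥ 0`) and for `r ≤ ½` (global maximum of `ψ ≤ 1`). [folklore] -/
theorem deriv_deficitStep_eq_zero {r : ℝ} (hr : 1 ≤ r ∨ r ≤ 1 / 2) : deriv deficitStep r = 0 := by
  rcases hr with hr | hr
  · have hmin : IsLocalMin deficitStep r :=
      Filter.Eventually.of_forall fun x => by rw [deficitStep_eq_zero hr]; exact deficitStep_nonneg x
    exact hmin.deriv_eq_zero
  · have hmax : IsLocalMax deficitStep r :=
      Filter.Eventually.of_forall fun x => by rw [deficitStep_eq_one hr]; exact deficitStep_le_one x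
    exact hmax.deriv_eq_zero

/-- ★ **Off the window the patched field has zero divergence**: if `F₀(M) ≥ t₀` (`t₀ > 0`) then `Σ_j ∂_j[ψ(F₀/t₀)(χc¹_j + (1−χ)c²_j)](M) = 0`. [folklore] -/
theorem patch_div_eq_zero_of_ge (τ : ι → ((Fin (2 * L - 1 + 1) × Edge 3 L) ⊕ Site 3 L) → Matrix (Fin 2) (Fin 2) ℂ)
    {χ : ((Fin (2 * L - 1 + 1) → Edge 3 L → Matrix (Fin 2) (Fin 2) ℂ) × (Site 3 L → Matrix (Fin 2) (Fin 2) ℂ)) → ℝ} (hχ : ContDiff ℝ ∞ χ)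
    {c₁ c₂ : ι → ((Fin (2 * L - 1 + 1) → Edge 3 L → Matrix (Fin 2) (Fin 2) ℂ) × (Site 3 L → Matrix (Fin 2) (Fin 2) ℂ)) → ℝ}
    (h₁ : ∀ j, ContDiff ℝ ∞ (c₁ j)) (h₂ : ∀ j, ContDiff ℝ ∞ (c₂ j)) {t₀ : ℝ} (ht₀ : 0 < t₀)
    (M : (Fin (2 * L - 1 + 1) → Edge 3 L → Matrix (Fin 2) (Fin 2) ℂ) × (Site 3 L → Matrix (Fin 2) (Fin 2) ℂ)) (hF : t₀ ≤ ringPoly L M) :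
    ∑ j, frameD (τ j) (fun M' => deficitStep (ringPoly L M' / t₀) * (χ M' * c₁ j M' + (1 - χ M') * c₂ j M')) M = 0 := by
  have hr : 1 ≤ ringPoly L M / t₀ := by rw [le_div_iff₀ ht₀, one_mul]; exact hF
  rw [sum_frameD_patch τ hχ h₁ h₂ t₀ M, deriv_deficitStep_eq_zero (Or.inl hr), deficitStep_eq_zero hr]
  simp

/-- ★ **Off the window the patched field has zero drive**: if `F₀(M) ≥ t₀` then `Σ_j c_j(M)·g_j(M) = 0`. [folklore] -/
theorem patch_drive_eq_zero_of_ge (τ : ι → ((Fin (2 * L - 1 + 1) × Edge 3 L) ⊕ Site 3 L) → Matrix (Fin 2) (Fin 2) ℂ)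
    (χ : ((Fin (2 * L - 1 + 1) → Edge 3 L → Matrix (Fin 2) (Fin 2) ℂ) × (Site 3 L → Matrix (Fin 2) (Fin 2) ℂ)) → ℝ)
    (c₁ c₂ : ι → ((Fin (2 * L - 1 + 1) → Edge 3 L → Matrix (Fin 2) (Fin 2) ℂ) × (Site 3 L → Matrix (Fin 2) (Fin 2) ℂ)) → ℝ) {t₀ : ℝ} (ht₀ : 0 < t₀)
    (M : (Fin (2 * L - 1 + 1) → Edge 3 L → Matrix (Fin 2) (Fin 2) ℂ) × (Site 3 L → Matrix (Fin 2) (Fin 2) ℂ)) (hF : t₀ ≤ ringPoly L M) :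
    ∑ j, deficitStep (ringPoly L M / t₀) * (χ M * c₁ j M + (1 - χ M) * c₂ j M) * frameGrad (L := L) τ M j = 0 := by
  have hr : 1 ≤ ringPoly L M / t₀ := by rw [le_div_iff₀ ht₀, one_mul]; exact hF
  simp [deficitStep_eq_zero hr]

/-- ★★ **(pos), WINDOW form**: the pieces' positivity is only needed on `{F₀ < t₀}`. [folklore] -/
theorem patch_drive_nonneg_window (τ : ι → ((Fin (2 * L - 1 + 1) × Edge 3 L) ⊕ Site 3 L) → Matrix (Fin 2) (Fin 2) ℂ)
    (χ : ((Fin (2 * L - 1 + 1) → Edge 3 L → Matrix (Fin 2) (Fin 2) ℂ) × (Site 3 L → Matrix (Fin 2) (Fin 2) ℂ)) → ℝ)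
    (c₁ c₂ : ι → ((Fin (2 * L - 1 + 1) → Edge 3 L → Matrix (Fin 2) (Fin 2) ℂ) × (Site 3 L → Matrix (Fin 2) (Fin 2) ℂ)) → ℝ) {t₀ : ℝ} (ht₀ : 0 < t₀)
    (M : (Fin (2 * L - 1 + 1) → Edge 3 L → Matrix (Fin 2) (Fin 2) ℂ) × (Site 3 L → Matrix (Fin 2) (Fin 2) ℂ))
    (h0 : 0 ≤ χ M) (h1 : χ M ≤ 1) (hg : ringPoly L M < t₀ → χ M ≠ 0 → 0 ≤ ∑ j, c₁ j M * frameGrad (L := L) τ M j)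
    (hc : ringPoly L M < t₀ → χ M ≠ 1 → 0 ≤ ∑ j, c₂ j M * frameGrad (L := L) τ M j) :
    0 ≤ ∑ j, deficitStep (ringPoly L M / t₀) * (χ M * c₁ j M + (1 - χ M) * c₂ j M) * frameGrad (L := L) τ M j := by
  by_cases hF : ringPoly L M < t₀
  · exact patch_drive_nonneg τ χ c₁ c₂ t₀ M h0 h1 (hg hF) (hc hF)
  · rw [patch_drive_eq_zero_of_ge τ χ c₁ c₂ ht₀ M (le_of_not_gt hF)]

/-- ★★★ **(div), SIGNED, WINDOW form**: all hypotheses on the pieces and on the cross term are only needed on `{F₀ < t₀}`; off the window the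
divergence is `0 ≤ T`. [cite: Griffiths1964] -/
theorem patch_div_le_signed_window (τ : ι → ((Fin (2 * L - 1 + 1) × Edge 3 L) ⊕ Site 3 L) → Matrix (Fin 2) (Fin 2) ℂ)
    {χ : ((Fin (2 * L - 1 + 1) → Edge 3 L → Matrix (Fin 2) (Fin 2) ℂ) × (Site 3 L → Matrix (Fin 2) (Fin 2) ℂ)) → ℝ} (hχ : ContDiff ℝ ∞ χ)
    {c₁ c₂ : ι → ((Fin (2 * L - 1 + 1) → Edge 3 L → Matrix (Fin 2) (Fin 2) ℂ) × (Site 3 L → Matrix (Fin 2) (Fin 2) ℂ)) → ℝ}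
    (h₁ : ∀ j, ContDiff ℝ ∞ (c₁ j)) (h₂ : ∀ j, ContDiff ℝ ∞ (c₂ j)) {t₀ D X T : ℝ} (ht₀ : 0 < t₀) (hT0 : 0 ≤ T) (hDX : 0 ≤ D + X) (hT : D + X ≤ T)
    (M : (Fin (2 * L - 1 + 1) → Edge 3 L → Matrix (Fin 2) (Fin 2) ℂ) × (Site 3 L → Matrix (Fin 2) (Fin 2) ℂ))
    (h0 : 0 ≤ χ M) (h1 : χ M ≤ 1)
    (hg : ringPoly L M < t₀ → χ M ≠ 0 → 0 ≤ ∑ j, c₁ j M * frameGrad (L := L) τ M j)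
    (hc : ringPoly L M < t₀ → χ M ≠ 1 → 0 ≤ ∑ j, c₂ j M * frameGrad (L := L) τ M j)
    (hdiv₁ : ringPoly L M < t₀ → χ M ≠ 0 → ∑ j, frameD (τ j) (c₁ j) M ≤ D)
    (hdiv₂ : ringPoly L M < t₀ → χ M ≠ 1 → ∑ j, frameD (τ j) (c₂ j) M ≤ D)
    (hX : ringPoly L M < t₀ → ∑ j, frameD (τ j) χ M * (c₁ j M - c₂ j M) ≤ X) :
    ∑ j, frameD (τ j) (fun M' => deficitStep (ringPoly L M' / t₀) * (χ M' * c₁ j M' + (1 - χ M') * c₂ j M')) M ≤ T := by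
  by_cases hF : ringPoly L M < t₀
  · exact patch_div_le_target_signed τ hχ h₁ h₂ ht₀ M h0 h1 (hg hF) (hc hF) (hdiv₁ hF) (hdiv₂ hF) (hX hF) hDX hT
  · rw [patch_div_eq_zero_of_ge τ hχ h₁ h₂ ht₀ M (le_of_not_gt hF)]
    exact hT0

/-- ★★ **(drive), WINDOW form** on `{F₀ ≤ t₀/2}` (there `F₀ < t₀` automatically): the pieces' drive inequalities where weighted give `a ≤ Σ_j c_j g_j`.
[cite: Griffiths1964] -/
theorem patch_drive_window (τ : ι → ((Fin (2 * L - 1 + 1) × Edge 3 L) ⊕ Site 3 L) → Matrix (Fin 2) (Fin 2) ℂ)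
    (χ : ((Fin (2 * L - 1 + 1) → Edge 3 L → Matrix (Fin 2) (Fin 2) ℂ) × (Site 3 L → Matrix (Fin 2) (Fin 2) ℂ)) → ℝ)
    (c₁ c₂ : ι → ((Fin (2 * L - 1 + 1) → Edge 3 L → Matrix (Fin 2) (Fin 2) ℂ) × (Site 3 L → Matrix (Fin 2) (Fin 2) ℂ)) → ℝ) {t₀ a : ℝ}
    (M : (Fin (2 * L - 1 + 1) → Edge 3 L → Matrix (Fin 2) (Fin 2) ℂ) × (Site 3 L → Matrix (Fin 2) (Fin 2) ℂ))
    (ht₀ : 0 < t₀) (hF : ringPoly L M ≤ t₀ / 2) (h0 : 0 ≤ χ M) (h1 : χ M ≤ 1)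
    (hg : ringPoly L M < t₀ → χ M ≠ 0 → a ≤ ∑ j, c₁ j M * frameGrad (L := L) τ M j)
    (hc : ringPoly L M < t₀ → χ M ≠ 1 → a ≤ ∑ j, c₂ j M * frameGrad (L := L) τ M j) :
    a ≤ ∑ j, deficitStep (ringPoly L M / t₀) * (χ M * c₁ j M + (1 - χ M) * c₂ j M) * frameGrad (L := L) τ M j := by
  have hF' : ringPoly L M < t₀ := by linarith
  exact patch_drive τ χ c₁ c₂ M ht₀ hF h0 h1 (hg hF') (hc hF')

end Summit.QuantumFields.YangMills.Theorems.VirialFluxGap.FieldPatching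

end
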